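import Literature.Analysis.FluidPDE.PassiveScalarDiagMildBounds
import HarnessLib

/-!
# Mild (Duhamel) formulation of the passive scalar equation with constant diagonal diffusion and
  bounded drift, IV: uniform smallness of the frequency tails of the Duhamel integral

Analysis/FluidPDE proof-support file (everything proved), sequel of `PassiveScalarDiagMildBounds`.
The Duhamel coefficient `D^λ(θ)(t)` lies in `ℓ²` with tails that are small UNIFORMLY in
`t ∈ [0,T]`: `∑_{k ∈ F \ F₀} ‖D^λ(θ)(t)(k)‖² ≤ (2κ)⁻¹ ∫_{(0,T)} tailWeight(F₀)` where
`tailWeight(F₀)(s) = ∑ⱼ aⱼ⁻¹ (∫(uⱼθ)(s)² - ∑_{k∈F₀}‖𝓕(uⱼ(s)θ(s))(k)‖²)` (`Torus.tailWeight`), and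
`∫_{(0,T)} tailWeight(freqBall N) → 0` by dominated convergence in time (at a.e. time the tail
weight is `∑ⱼ aⱼ⁻¹ ‖(uⱼθ)(s) - P_N(uⱼθ)(s)‖²_{L²} → 0`, Parseval, Grafakos 2014 Prop. 3.2.7 (3)). This
is what makes the mild solution continuous in time with values in `ℓ² ≅ L²(T^d)` (strong `L²`
continuity), not merely coefficientwise.

## References

* A. Pazy, *Semigroups of Linear Operators and Applications to Partial Differential Equations*,
  Springer 1983, Ch. 4 §4.2 (mild solutions, Duhamel's formula (2.3), Def. 2.3, Cor. 2.5).
* L. C. Evans, *Partial Differential Equations*, 2nd ed. (AMS 2010), §7.1.2–7.1.3.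
* R. J. DiPerna, P.-L. Lions, Invent. Math. 98 (1989) 511–547, §II.1 (the weak class).
* L. Grafakos, *Classical Fourier Analysis*, 3rd ed. (2014), Prop. 3.2.6 (4), (8), Prop. 3.2.7 (3).
-/

noncomputable section

open MeasureTheory TopologicalSpace Set Function Filter UnitAddTorus
open _root_.Topology
open scoped ENNReal NNReal InnerProductSpace ComplexConjugate

namespace Literature.Analysis.FluidPDE

namespace Torus

open Literature.Analysis.FunctionSpaces.Torus Literature.Analysis.FunctionSpaces

variable {d : Type*} [Fintype d]

section Tails

variable {T U E κ lam : ℝ} {a : d → ℝ} {u : ℝ → UnitAddTorus d → EuclideanSpace ℝ d}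
  {θ : ℝ → UnitAddTorus d → ℝ}


/-- The **tail weight** beyond a finite frequency set `F₀`:
`∑ⱼ aⱼ⁻¹ (∫ (uⱼθ)(s)² - ∑_{k∈F₀} ‖𝓕(uⱼ(s)θ(s))(k)‖²)` — by Parseval the sum over `k ∉ F₀` of the
transport weight (at a.e. time). [cite: Grafakos2014, Prop. 3.2.7 (3)] -/
def tailWeight (a : d → ℝ) (u : ℝ → UnitAddTorus d → EuclideanSpace ℝ d) (θ : ℝ → UnitAddTorus d → ℝ)
    (F₀ : Finset (d → ℤ)) (s : ℝ) : ℝ :=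
  ∑ j, (a j)⁻¹ * ((∫ x, (u s x j * θ s x) ^ 2) -
    ∑ k ∈ F₀, ‖mFourierCoeff (fun x => ((u s x j * θ s x : ℝ) : ℂ)) k‖ ^ 2)

/-- For a.e. `s ∈ (0,T)`: the transport weight summed over `F \ F₀` is at most the tail weight
beyond `F₀` (Bessel on `(F \ F₀) ∪ F₀`). [cite: Grafakos2014, Prop. 3.2.7 (3)] -/
theorem ae_sum_sdiff_transportWeight_le_tailWeight (hu : DriftBound T u U) (hθ : IsL2Field T E θ)
    (ha : ∀ i, 0 < a i) (F₀ : Finset (d → ℤ)) :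
    ∀ᵐ s ∂((volume : Measure ℝ).restrict (Ioo 0 T)), ∀ F : Finset (d → ℤ),
      ∑ k ∈ F \ F₀, transportWeight a u θ s k ≤ tailWeight a u θ F₀ s := by
  classical
  have h : ∀ᵐ s ∂((volume : Measure ℝ).restrict (Ioo 0 T)), ∀ j,
      MemLp (fun x => u s x j * θ s x) 2 volume ∧ ∫ x, (u s x j * θ s x) ^ 2 ≤ U ^ 2 * E := by
    rw [eventually_all]
    exact fun j => ae_memLp_apply_mul hu hθ j
  filter_upwards [h] with s hs F
  simp only [transportWeight_apply, tailWeight]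
  rw [Finset.sum_comm]
  refine Finset.sum_le_sum fun j _ => ?_
  rw [← Finset.mul_sum]
  refine mul_le_mul_of_nonneg_left ?_ (inv_nonneg.2 (ha j).le)
  rw [le_sub_iff_add_le, ← Finset.sum_union Finset.sdiff_disjoint]
  exact sum_le_hasSum _ (fun _ _ => sq_nonneg _) (hasSum_sq_norm_mFourierCoeff_ofReal (hs j).1)

/-- For a.e. `s ∈ (0,T)`: `0 ≤ tailWeight ≤ (∑ⱼaⱼ⁻¹) U² E`. [cite: Grafakos2014, Prop. 3.2.7 (3)] -/
theorem ae_tailWeight_mem_Icc (hu : DriftBound T u U) (hθ : IsL2Field T E θ) (ha : ∀ i, 0 < a i)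
    (F₀ : Finset (d → ℤ)) :
    ∀ᵐ s ∂((volume : Measure ℝ).restrict (Ioo 0 T)),
      0 ≤ tailWeight a u θ F₀ s ∧ tailWeight a u θ F₀ s ≤ (∑ j, (a j)⁻¹) * (U ^ 2 * E) := by
  have h : ∀ᵐ s ∂((volume : Measure ℝ).restrict (Ioo 0 T)), ∀ j,
      MemLp (fun x => u s x j * θ s x) 2 volume ∧ ∫ x, (u s x j * θ s x) ^ 2 ≤ U ^ 2 * E := by
    rw [eventually_all]
    exact fun j => ae_memLp_apply_mul hu hθ j
  filter_upwards [h] with s hs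
  constructor
  · refine Finset.sum_nonneg fun j _ => mul_nonneg (inv_nonneg.2 (ha j).le) ?_
    rw [sub_nonneg]
    exact sum_le_hasSum _ (fun _ _ => sq_nonneg _) (hasSum_sq_norm_mFourierCoeff_ofReal (hs j).1)
  · rw [tailWeight, Finset.sum_mul]
    refine Finset.sum_le_sum fun j _ => mul_le_mul_of_nonneg_left ?_ (inv_nonneg.2 (ha j).le)
    have h0 : 0 ≤ ∑ k ∈ F₀, ‖mFourierCoeff (fun x => ((u s x j * θ s x : ℝ) : ℂ)) k‖ ^ 2 :=
      Finset.sum_nonneg fun _ _ => sq_nonneg _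
    linarith [(hs j).2]

/-- `(uⱼθ)²` is integrable on `(0,T) × T^d`. [cite: DiPernaLions1989, §II.1 (12)–(14)] -/
theorem integrable_apply_mul_sq (hu : DriftBound T u U) (hθ : IsL2Field T E θ) (j : d) :
    Integrable (fun p : ℝ × UnitAddTorus d => (u p.1 p.2 j * θ p.1 p.2) ^ 2)
      (((volume : Measure ℝ).restrict (Ioo 0 T)).prod volume) := by
  have hθ2 : Integrable (fun p : ℝ × UnitAddTorus d => θ p.1 p.2 ^ 2)
      (((volume : Measure ℝ).restrict (Ioo 0 T)).prod volume) := hθ.memLp_uncurry.integrable_sq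
  refine (hθ2.const_mul (U ^ 2)).mono' (((hu.aestronglyMeasurable_apply j).mul hθ.aestronglyMeasurable).pow 2) ?_
  filter_upwards [hu.ae_abs_apply_le j] with p hp
  rw [Real.norm_of_nonneg (sq_nonneg _), mul_pow]
  refine mul_le_mul_of_nonneg_right ?_ (sq_nonneg _)
  exact sq_le_sq' (abs_le.1 hp).1 (abs_le.1 hp).2

/-- The tail weight is integrable in time on `(0,T)`. [cite: DiPernaLions1989, §II.1 (12)–(14)] -/
theorem integrable_tailWeight (hu : DriftBound T u U) (hθ : IsL2Field T E θ) (F₀ : Finset (d → ℤ)) :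
    Integrable (tailWeight a u θ F₀) ((volume : Measure ℝ).restrict (Ioo 0 T)) := by
  haveI : IsFiniteMeasure ((volume : Measure ℝ).restrict (Ioo 0 T)) :=
    isFiniteMeasure_restrict.2 measure_Ioo_lt_top.ne
  unfold tailWeight
  refine integrable_finsetSum _ fun j _ => Integrable.const_mul (Integrable.sub ?_ ?_) _
  · exact (integrable_apply_mul_sq hu hθ j).integral_prod_left
  · refine integrable_finsetSum _ fun k _ => ?_
    refine Integrable.of_bound (((integrable_mFourierCoeff_apply_mul hu hθ j k).aestronglyMeasurable.norm.pow 2))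
      (U ^ 2 * E) ?_
    filter_upwards [ae_memLp_apply_mul hu hθ j] with s hs
    rw [Real.norm_of_nonneg (sq_nonneg _)]
    exact (sq_norm_mFourierCoeff_le_integral_sq hs.1 k).trans hs.2

/-- **Tail bound for the Duhamel coefficient**, uniform in `t ∈ [0,T]` and in the finite set `F`:
`∑_{k ∈ F \ F₀} ‖D^λ(θ)(t)(k)‖² ≤ (2κ)⁻¹ ∫_{(0,T)} tailWeight(F₀)`. [cite: Evans2010, §7.1.2 Thm. 2 (energy estimates), with Pazy1983 Ch. 4 §4.2 (2.3)] -/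
theorem sum_sdiff_norm_sq_duhamelCoeff_le (hu : DriftBound T u U) (hθ : IsL2Field T E θ) (ha : ∀ i, 0 < a i)
    (hκ : 0 < κ) (hlam : 0 < lam) {t : ℝ} (ht : t ∈ Icc 0 T) (F F₀ : Finset (d → ℤ)) :
    ∑ k ∈ F \ F₀, ‖duhamelCoeff κ a lam u θ t k‖ ^ 2 ≤
      (2 * κ)⁻¹ * ∫ s in Ioo 0 T, tailWeight a u θ F₀ s := by
  refine (sum_norm_sq_duhamelCoeff_le hu hθ ha hκ hlam ht (F \ F₀)).trans ?_
  refine mul_le_mul_of_nonneg_left ?_ (by positivity)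
  -- drop the damping factor, enlarge the time interval, and use Bessel beyond `F₀`
  have hle : (volume : Measure ℝ).restrict (Ioc 0 t) ≤ (volume : Measure ℝ).restrict (Ioo 0 T) := by
    rw [← Measure.restrict_congr_set (Ioo_ae_eq_Ioc (μ := (volume : Measure ℝ)))]
    exact Measure.restrict_mono (Ioo_subset_Ioo_right ht.2) le_rfl
  have hi1 : Integrable (fun s => Real.exp (-(lam * (t - s))) * ∑ k ∈ F \ F₀, transportWeight a u θ s k)
      ((volume : Measure ℝ).restrict (Ioc 0 t)) := by
    have e : (fun s => Real.exp (-(lam * (t - s))) * ∑ k ∈ F \ F₀, transportWeight a u θ s k) =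
        fun s => ∑ k ∈ F \ F₀, Real.exp (-(lam * (t - s))) * transportWeight a u θ s k := by
      funext s; rw [Finset.mul_sum]
    rw [e]
    exact integrable_finsetSum _ fun k _ => integrableOn_exp_mul_transportWeight hu hθ ha ht k
  have hi2 : Integrable (tailWeight a u θ F₀) ((volume : Measure ℝ).restrict (Ioc 0 t)) :=
    (integrable_tailWeight hu hθ F₀).mono_measure hle
  calc ∫ s in Ioc 0 t, Real.exp (-(lam * (t - s))) * ∑ k ∈ F \ F₀, transportWeight a u θ s k
      ≤ ∫ s in Ioc 0 t, tailWeight a u θ F₀ s := by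
        refine integral_mono_ae hi1 hi2 ?_
        filter_upwards [ae_restrict_Ioc_of_ae_restrict_Ioo ht.2 (ae_sum_sdiff_transportWeight_le_tailWeight hu hθ ha F₀),
          ae_restrict_mem measurableSet_Ioc] with s hs hsI
        have hg0 : 0 ≤ ∑ k ∈ F \ F₀, transportWeight a u θ s k :=
          Finset.sum_nonneg fun k _ => transportWeight_nonneg ha u θ s k
        have he : Real.exp (-(lam * (t - s))) ≤ 1 := by
          rw [Real.exp_le_one_iff, neg_nonpos]; exact mul_nonneg hlam.le (by linarith [hsI.2])
        calc Real.exp (-(lam * (t - s))) * ∑ k ∈ F \ F₀, transportWeight a u θ s k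
            ≤ 1 * ∑ k ∈ F \ F₀, transportWeight a u θ s k := mul_le_mul_of_nonneg_right he hg0
          _ ≤ tailWeight a u θ F₀ s := by rw [one_mul]; exact hs F
    _ ≤ ∫ s in Ioo 0 T, tailWeight a u θ F₀ s := by
        refine integral_mono_measure hle ?_ (integrable_tailWeight hu hθ F₀)
        filter_upwards [ae_tailWeight_mem_Icc hu hθ ha F₀] with s hs
        exact hs.1

variable [DecidableEq d]

/-- **The tails of the Duhamel coefficient are uniformly small**: along the frequency balls,
`∫_{(0,T)} tailWeight(freqBall N) → 0` (dominated convergence in time; at a.e. time the tail weight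
is `∑ⱼ aⱼ⁻¹ ‖(uⱼθ)(s) - P_N(uⱼθ)(s)‖²_{L²} → 0` by Parseval, `Torus.tendsto_integral_sq_sub_scalarTruncate`). [cite: Grafakos2014, Prop. 3.2.7 (3)] -/
theorem tendsto_integral_tailWeight (hu : DriftBound T u U) (hθ : IsL2Field T E θ) (ha : ∀ i, 0 < a i) :
    Tendsto (fun N => ∫ s in Ioo 0 T, tailWeight a u θ (freqBall N) s) atTop (𝓝 0) := by
  haveI : IsFiniteMeasure ((volume : Measure ℝ).restrict (Ioo 0 T)) :=
    isFiniteMeasure_restrict.2 measure_Ioo_lt_top.ne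
  have h : ∀ᵐ s ∂((volume : Measure ℝ).restrict (Ioo 0 T)), ∀ j,
      MemLp (fun x => u s x j * θ s x) 2 volume ∧ ∫ x, (u s x j * θ s x) ^ 2 ≤ U ^ 2 * E := by
    rw [eventually_all]
    exact fun j => ae_memLp_apply_mul hu hθ j
  have hlim : ∀ᵐ s ∂((volume : Measure ℝ).restrict (Ioo 0 T)),
      Tendsto (fun N => tailWeight a u θ (freqBall N) s) atTop (𝓝 0) := by
    filter_upwards [h] with s hs
    have e : ∀ N, tailWeight a u θ (freqBall N) s =
        ∑ j, (a j)⁻¹ * ∫ x, (u s x j * θ s x - scalarTruncate N (fun x => u s x j * θ s x) x) ^ 2 := by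
      intro N
      simp only [tailWeight]
      refine Finset.sum_congr rfl fun j _ => ?_
      rw [integral_sq_sub_scalarTruncate (hs j).1 N]
    simp_rw [e]
    have : (0 : ℝ) = ∑ j : d, (a j)⁻¹ * 0 := by simp
    rw [this]
    exact tendsto_finsetSum _ fun j _ => (tendsto_integral_sq_sub_scalarTruncate (hs j).1).const_mul _
  have hbound : ∀ N, ∀ᵐ s ∂((volume : Measure ℝ).restrict (Ioo 0 T)),
      ‖tailWeight a u θ (freqBall N) s‖ ≤ (∑ j, (a j)⁻¹) * (U ^ 2 * E) := by
    intro N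
    filter_upwards [ae_tailWeight_mem_Icc hu hθ ha (freqBall N)] with s hs
    rw [Real.norm_of_nonneg hs.1]; exact hs.2
  have := tendsto_integral_of_dominated_convergence (fun _ => (∑ j, (a j)⁻¹) * (U ^ 2 * E))
    (fun N => (integrable_tailWeight hu hθ (freqBall N)).aestronglyMeasurable) (integrable_const _) hbound hlim
  simpa using this

/-- **Uniform tail smallness**, quantified form: for every `ε > 0` there is `N` such that for all
`t ∈ [0,T]` and all finite `F`, `∑_{k ∈ F \ freqBall N} ‖D^λ(θ)(t)(k)‖² ≤ ε`. [cite: Evans2010, §7.1.2 Thm. 2 (energy estimates), with Pazy1983 Ch. 4 §4.2 (2.3)] -/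
theorem exists_sum_sdiff_norm_sq_duhamelCoeff_le (hu : DriftBound T u U) (hθ : IsL2Field T E θ)
    (ha : ∀ i, 0 < a i) (hκ : 0 < κ) (hlam : 0 < lam) {ε : ℝ} (hε : 0 < ε) :
    ∃ N : ℕ, ∀ t ∈ Icc 0 T, ∀ F : Finset (d → ℤ),
      ∑ k ∈ F \ freqBall N, ‖duhamelCoeff κ a lam u θ t k‖ ^ 2 ≤ ε := by
  have h := (tendsto_integral_tailWeight hu hθ ha).const_mul (2 * κ)⁻¹
  rw [mul_zero] at h
  obtain ⟨N, hN⟩ := (h.eventually (gt_mem_nhds hε)).exists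
  exact ⟨N, fun t ht F => (sum_sdiff_norm_sq_duhamelCoeff_le hu hθ ha hκ hlam ht F (freqBall N)).trans hN.le⟩

end Tails

end Torus

end Literature.Analysis.FluidPDE

end
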